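import Literature.AlgebraicGeometry.Resolution.RegularLocalRingsQuotient
import Mathlib.RingTheory.MvPolynomial.Homogeneous
import Mathlib.FieldTheory.Perfect
import Mathlib.RingTheory.AdicCompletion.Basic
import Mathlib.RingTheory.KrullDimension.Basic
import HarnessLib

/-!
# Crux `Steer` (stmt-ResolutionOfSingularities-16345), chain W4.1 — β-leaf HAT STAGE WORDS:
# `IsHatRing`, `IsArithStage`, `IsXChartHat`, `IsYChartHat`

OURS (campaign `res-hironaka`, rung L ★L-G4, slot W4.1). AUTHOR of the words: res-L0-w41-idea-1 (β-leaf `Sketch-idea-1-v18-hatleaf.v184-J4K7.lean`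
a588f3d5e96959f0 §2♯ «Stage» and §5 «LettersHat»; the four `def` bodies are byte-identical in v18.4-J4K7SH ace46a15f53b37fc and in the route documents
v18.8 ab34af89a05fc277 / v18.9 67b4cadca59a5f06 — checked by script, res-L0-w41-plan-1 RULING 201(d)); FILED VERBATIM by res-L0-w41-stub-4 g7 on
res-L0-w41-plan-1 RULINGS 199(c)/201(d)/207(a) («stub-4 files `…BetaHatStageWords`»), docstring tags «[folklore]» respelled «(folklore)» (chain lint),
nothing else changed; audited by res-L0-w41-tri-2 (TRIAGE v26/v27 ring-level words PASS ×4). Replaces the role of no printed item; NOT a statement of the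
manuscript under review [claim: Hironaka2017, status: under-review]; AI-produced, weaker than expert review. DEFINITIONS ONLY (no theorem, no instance,
no notation); namespace `…Theorems.SwitchingDichotomy.BetaPolygon` (the β-polygon words of res-L0-w41-stub-1, p536143/p540729, which the β-leaf `open`s).

* `IsHatRing S` — complete regular local ring of dimension four with PERFECT residue field (the completed run member `Ŝ_i`).
* `IsArithStage S x y z w u f d` — the uniform STAGE DATUM of the β-block: r.s.o.p. `(x,y,z,w)`, square-free twist `u ∈ {1, x, y, xy}` (J4 repair),
  residue form of `f` BINARY of degree `d` in `(z, w)` and ROOTLESS over the residue field, modulo `(x,y)·𝔪^(d−1) + 𝔪^(d+1)`.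
* `IsXChartHat φ σ σ₁ x y z w c v₁ z₁ w₁` / `IsYChartHat φ σ σ₁ x y z w x₁ z₁ w₁` — the completed chart map of a POINT blow-up in section form:
  coefficient fields `σ, σ₁`, compatibility, `κ₁ = κ[c]` (resp. `κ₁ = κ`), the new r.s.o.p., and the substitution equalities.
Consumers: the β-leaf slots `ShearLetterHat`, `HatBaseChangeX/Y`, `ConePersistenceX`, `XLetterPushHat`, `PreparedTransferX/YHat`, … and the kernels
`Theorems/FrobeniusClosingSteerHatFiniteEtale.lean` / `…HatBaseChangeChart.lean` (res-L0-w41-stub-4, words-free parts 1–2 of `HatBaseChangeX`).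

[cite: CossartJannsenSaito2020, Lemma 12.1, Lemma 13.6] [cite: Matsumura1987, Thm. 28.3] [folklore]
bears_on: LADDER-RESOLUTION L ★L-G4 W4.1 (crux `Steer`, binder hK4ⁿᶜ, β-leaf of record v18.4-J4K7).
-/

noncomputable section

-- `Summit.<S>.<S>.…` duplicates the summit name by design (single-problem summit).
set_option linter.dupNamespace false

open IsLocalRing

namespace Summit.ResolutionOfSingularities.ResolutionOfSingularities.Theorems.SwitchingDichotomy.BetaPolygon

/-! ## §2♯ (β-leaf) The RING datum and the STAGE datum of the hat words -/

section Stage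

/-- `IsHatRing S`: a complete regular local ring of dimension four with PERFECT residue field (= `Ŝ_i` of the run: `R i` is regular (hreg′),
`AdicCompletion` is complete Noetherian of the same dimension, `P i` perfect (hperf)). RULING 150 (3): perfectness is BOUND. OURS. (folklore) -/
def IsHatRing (S : Type) [CommRing S] [IsLocalRing S] : Prop :=
  IsNoetherianRing S ∧ IsRegularLocalRing S ∧ IsAdicComplete (maximalIdeal S) S ∧ ringKrullDim S = 4 ∧
    PerfectField (ResidueField S)

/-- `IsArithStage S x y z w u f d` — the uniform STAGE DATUM of the β-block (A- and B-stages alike): `(x, y, z, w)` is a r.s.o.p., the twist `u`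
is a SQUARE-FREE monomial in `x, y` (`u ∈ {1, x, y, xy}`: J4 REPAIR R-J4a, res-D-pv-003 2026-08-27T16:14:22Z — squares of the old parameters
belong to the torsor coordinate, `(t·x^i y^j)² = x^(2i) y^(2j)·t²`; with a NON-square-free twist the cleaning group `f ↦ f + u·q²` is too small
UPSTAIRS while the letter's normalisation `φ(u f) = φy^(2k)·(u₁ f₁)` halves it DOWNSTAIRS, and (II-Y) fails as typed: `u = x²y³`,
`f = Ψ(z,w) + x²yz²`, vertex `(2,1)` prepared mod `u`·squares, y-chart: `u₁ = x₁²`, `f₁ = Ψ(z₁,w₁) + x₁²y₁²z₁²` dissolved by `q₁ = y₁z₁`;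
the physical classes are `e₀ : {x, y} → Fin 2`, stub-4's (C1) convention `u = X^{ν(e₀)}` in p543008), and `f` has order `d` with residue form
BINARY AND ROOTLESS modulo the old parameters:
`f ≡ Ψ(z, w) (mod (x, y)·𝔪^(d−1) + 𝔪^(d+1))`, `Ψ` homogeneous of degree `d` with `Ψ̄(a, b) ≠ 0` for `(a, b) ≠ (0, 0)` over the residue field.
At an A-stage (`u = 1`) this is `ArithBinaryResidueAt` read in `Ŝ_i` (there `f ≡ Ψ(z,w) mod 𝔪^(d+1)`); at a B-stage the degree-`d` part of the
strict transform may acquire multiples of the exceptional parameter (`Ψ(Z,W) + X·G`), which the clause allows. OURS. (folklore) -/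
def IsArithStage (S : Type) [CommRing S] [IsLocalRing S] (x y z w u f : S) (d : ℕ) : Prop :=
  Ideal.span {x, y, z, w} = maximalIdeal S ∧ (∃ a b : ℕ, a ≤ 1 ∧ b ≤ 1 ∧ u = x ^ a * y ^ b) ∧
    ∃ Ψ : MvPolynomial (Fin 2) S, Ψ.IsHomogeneous d ∧
      (∀ a b : ResidueField S, (a ≠ 0 ∨ b ≠ 0) →
        MvPolynomial.eval ![a, b] (MvPolynomial.map (residue S) Ψ) ≠ 0) ∧
      f - MvPolynomial.eval ![z, w] Ψ ∈ Ideal.span {x, y} * maximalIdeal S ^ (d - 1) ⊔ maximalIdeal S ^ (d + 1)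

end Stage

/-! ## §5 (β-leaf) Chart presentations of the completed point blow-up in section form -/

section LettersHat
variable {S S₁ : Type} [CommRing S] [IsLocalRing S] [CommRing S₁] [IsLocalRing S₁]

/-- x-chart presentation of the completed chart map at the closed point `(1 : c : 0 : 0)` (strat-2 §5♭ binders, packaged). OURS. (folklore) -/
def IsXChartHat (φ : S →+* S₁) (σ : ResidueField S →+* S) (σ₁ : ResidueField S₁ →+* S₁)
    (x y z w : S) (c : ResidueField S₁) (v₁ z₁ w₁ : S₁) : Prop :=
  (∀ a, residue S (σ a) = a) ∧ (∀ b, residue S₁ (σ₁ b) = b) ∧ (∀ a, φ (σ a) = σ₁ (residue S₁ (φ (σ a)))) ∧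
  (∀ b : ResidueField S₁, ∃ P : Polynomial (ResidueField S), b = P.eval₂ ((residue S₁).comp (φ.comp σ)) c) ∧
  Ideal.span {φ x, v₁, z₁, w₁} = maximalIdeal S₁ ∧
  φ y = φ x * (σ₁ c + v₁) ∧ φ z = φ x * z₁ ∧ φ w = φ x * w₁

/-- y-chart presentation of the completed chart map at `(0 : 1 : 0 : 0)` (strat-2 §5♭ binders, packaged). OURS. (folklore) -/
def IsYChartHat (φ : S →+* S₁) (σ : ResidueField S →+* S) (σ₁ : ResidueField S₁ →+* S₁)
    (x y z w : S) (x₁ z₁ w₁ : S₁) : Prop :=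
  (∀ a, residue S (σ a) = a) ∧ (∀ b, residue S₁ (σ₁ b) = b) ∧ (∀ a, φ (σ a) = σ₁ (residue S₁ (φ (σ a)))) ∧
  Function.Surjective ((residue S₁).comp (φ.comp σ)) ∧
  Ideal.span {x₁, φ y, z₁, w₁} = maximalIdeal S₁ ∧
  φ x = φ y * x₁ ∧ φ z = φ y * z₁ ∧ φ w = φ y * w₁

end LettersHat

end Summit.ResolutionOfSingularities.ResolutionOfSingularities.Theorems.SwitchingDichotomy.BetaPolygon

end
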